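import Mathlib
import HarnessLib
import Summits.RiemannHypothesis.RiemannHypothesis.Theorems.IntegerScrewCouplingForm
import Summits.RiemannHypothesis.RiemannHypothesis.Theorems.IntegerScrewWalkGenerator
import Summits.RiemannHypothesis.RiemannHypothesis.Theorems.IntegerScrewSemigroupComparison

/-!
# Route `IntegerScrew` — PROP. N4 in the kernel: the coupling matrix is the DOOB TRANSFORM of
# `L·walkGen M + diag(R)`, so `(e^{tN_M})_{kk} = (e^{t(L·walkGen M + diag R)})_{kk}`, and the Feynman–Kac
# sandwich `e^{(L−6)t}·p⁰_{kk}(tL) ≤ (e^{tN_M})_{kk} ≤ e^{(L+6)t}·p⁰_{kk}(tL)` (PIVOT-LAW 13.10, 13.45)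

PIVOT-LAW §13.10 (PROP. N4, rh-explicit A6-PIVOT): conjugated by `Δ = diag(√k)`, the von Mangoldt coupling
matrix `N_M` (`IntegerScrewCouplingDefs`) becomes the pure jump-rate matrix `A` of the random multiplicative
walk — `A(k, kn) = Λ(n)/n`, `A(kn, k) = Λ(n)` — i.e. `A = L·walkGen M + diag(R)` with `L = log M`,
`walkGen M` the τ-time generator of `IntegerScrewWalkGenerator` and `R(k) = L·Σ_j walkRate(k,j)
= log k + Σ_{n ≤ M/k} Λ(n)/n` the total jump rate (`= log M − γ₀ + ε(M/k)`).  Proved here: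

* `diagonal_sqrt_mul_couplingMatrix` — `Δ·N_M = A·Δ` (entrywise arithmetic, `√(kn) = √k·√n`);
* `exp_smul_couplingMatrix_apply_self` — `(e^{tN_M})_{kk} = (e^{tA})_{kk}` for every state `k` and real `t`
  (`Matrix.exp_conj'`);
* `walkTotalRate_eq`, `walkTotalRate_le`, `le_walkTotalRate` — `R(k) = log k + Σ_{n ≤ M/k}Λ(n)/n ∈ [L − 6, L + 6]`
  (the tree's Mertens bounds `IntegerScrewVonMangoldtCoupling.sum_vonMangoldt_div_self_le_log_sub` /
  `log_sub_le_sum_vonMangoldt_div_self`);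
* `exp_couplingMatrix_apply_self_le` / `_ge` — the sandwich displayed in the title, with
  `p⁰_{kk}(τ) = (e^{τ·walkGen M})_{kk}` the return probability of THEOREM C♯ (`IntegerScrewSemigroupComparison`'s
  Feynman–Kac comparison applied to `Q = L·walkGen M`, `d = R`).

RH-free; nothing here bears on the truth of RH.  References: PIVOT-LAW §13.10, §13.45 (rh-explicit A6-PIVOT);
M. Suzuki, J. Lond. Math. Soc. (2) 108 (2023) 1448–1487 [Suzuki2023] for the screw matrices.
-/

noncomputable section

-- D-0017: `Summit.<S>.<S>.…` is the designed namespace of a single-problem summit.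
set_option linter.dupNamespace false

namespace Summit.RiemannHypothesis.RiemannHypothesis.Theorems.IntegerScrew

open scoped Matrix.Norms.Operator
open NormedSpace Matrix Finset ArithmeticFunction

/-! ### The total jump rate `R(k) = L·Σ_j walkRate(k,j)` -/

/-- `L·walkRate(k,j)` for `L ≠ 0`: `Λ(j/k)/(j/k)` for a birth, `Λ(k/j)` for a death. -/
theorem log_mul_walkRate {L : ℝ} (hL : L ≠ 0) {k j : ℕ} (hkj : k ≠ j) :
    L * walkRate L k j =
      if k ∣ j then Λ (j / k) / ((j / k : ℕ) : ℝ) else if j ∣ k then Λ (k / j) else 0 := by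
  unfold walkRate
  rw [if_neg hkj]
  split_ifs with h1 h2
  · field_simp
  · field_simp
  · rw [mul_zero]

/-- **The total jump rate in arithmetic form**: for `2 ≤ M` and a state `k`,
`L·Σ_j walkRate(k,j) = log k + Σ_{n ≤ M/k} Λ(n)/n`. -/
theorem walkTotalRate_eq {M : ℕ} (hM : 2 ≤ M) (k : St M) :
    Real.log M * ∑ j : St M, walkRate (Real.log M) k j =
      Real.log (k : ℕ) + ∑ n ∈ Icc 1 (M / k), Λ n / n := by
  have hL : Real.log M ≠ 0 := (Real.log_pos (by exact_mod_cast hM)).ne'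
  have hk : 1 ≤ (k : ℕ) := (Finset.mem_Icc.1 k.2).1
  have hkM : (k : ℕ) ≤ M := (Finset.mem_Icc.1 k.2).2
  have hk0 : (k : ℕ) ≠ 0 := by omega
  rw [Finset.mul_sum, Finset.sum_coe_sort (Finset.Icc 1 M) (fun j => Real.log M * walkRate (Real.log M) k j)]
  have hsplit : ∀ j ∈ Finset.Icc 1 M, Real.log M * walkRate (Real.log M) k j =
      Real.log M * birthRate (Real.log M) k j + Real.log M * deathRate (Real.log M) k j := by
    intro j _
    rw [walkRate_eq_birth_add_death _ hk0, mul_add]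
  rw [Finset.sum_congr rfl hsplit, Finset.sum_add_distrib, ← Finset.mul_sum, ← Finset.mul_sum]
  have hb := sum_birthRate_eq (Real.log M) (M := M) hk (fun _ => (1 : ℝ))
  have hd := sum_deathRate_eq (Real.log M) (M := M) hk hkM (fun _ => (1 : ℝ))
  simp only [mul_one] at hb hd
  rw [hb, hd, Finset.mul_sum, Finset.mul_sum, add_comm]
  congr 1
  · have hdiv : ∑ d ∈ (k : ℕ).divisors, (Λ d : ℝ) = Real.log (k : ℕ) := vonMangoldt_sum
    rw [← hdiv]
    refine Finset.sum_congr rfl fun d _ => ?_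
    field_simp
  · refine Finset.sum_congr rfl fun n hn => ?_
    have hn : (0 : ℝ) < n := by exact_mod_cast (Finset.mem_Icc.1 hn).1
    field_simp

/-- Upper bound `R(k) ≤ log M + 6`. -/
theorem walkTotalRate_le {M : ℕ} (hM : 2 ≤ M) (k : St M) :
    Real.log M * ∑ j : St M, walkRate (Real.log M) k j ≤ Real.log M + 6 := by
  rw [walkTotalRate_eq hM k]
  have h := sum_vonMangoldt_div_self_le_log_sub (M := M) (k := (k : ℕ)) k.2
  linarith

/-- Lower bound `log M − 6 ≤ R(k)`. -/
theorem le_walkTotalRate {M : ℕ} (hM : 2 ≤ M) (k : St M) :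
    Real.log M - 6 ≤ Real.log M * ∑ j : St M, walkRate (Real.log M) k j := by
  rw [walkTotalRate_eq hM k]
  have h := log_sub_le_sum_vonMangoldt_div_self (M := M) (m := (k : ℕ)) k.2
  linarith

/-! ### The Doob transform `Δ·N_M = (L·walkGen M + diag R)·Δ`, `Δ = diag(√k)` -/

/-- **PROP. N4 (conjugation form)**: with `Δ = diag(√k)` and `A = L·walkGen M + diag(R)`,
`Δ·N_M = A·Δ` — i.e. `N_M(k,j)·√k = A(k,j)·√j`: `A(k,kn) = Λ(n)/n`, `A(kn,k) = Λ(n)`, zero diagonal. -/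
theorem diagonal_sqrt_mul_couplingMatrix {M : ℕ} (hM : 2 ≤ M) :
    diagonal (fun k : St M => Real.sqrt (k : ℕ)) * couplingMatrix M =
      (Real.log M • walkGen M +
          diagonal (fun k : St M => Real.log M * ∑ j : St M, walkRate (Real.log M) k j)) *
        diagonal (fun k : St M => Real.sqrt (k : ℕ)) := by
  have hL : Real.log M ≠ 0 := (Real.log_pos (by exact_mod_cast hM)).ne'
  ext k j
  rw [diagonal_mul, mul_diagonal, Matrix.add_apply, Matrix.smul_apply, smul_eq_mul, diagonal_apply]
  have hk : 1 ≤ (k : ℕ) := (Finset.mem_Icc.1 k.2).1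
  have hj : 1 ≤ (j : ℕ) := (Finset.mem_Icc.1 j.2).1
  by_cases hkj : k = j
  · -- diagonal: N_kk = 0 and L·walkGen_kk + R_k = 0
    subst hkj
    rw [if_pos rfl, walkGen, if_pos rfl, couplingMatrix_apply_eq_add, if_pos dvd_rfl,
      Nat.div_self hk, vonMangoldt_apply_one, zero_div, add_zero, mul_zero, mul_neg, neg_add_cancel,
      zero_mul]
  · have hkj' : (k : ℕ) ≠ (j : ℕ) := fun h => hkj (Subtype.ext h)
    rw [if_neg hkj, add_zero, walkGen, if_neg hkj, log_mul_walkRate hL hkj', couplingMatrix,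
      Matrix.of_apply]
    have hk0 : (0 : ℝ) < (k : ℕ) := by exact_mod_cast hk
    have hj0 : (0 : ℝ) < (j : ℕ) := by exact_mod_cast hj
    by_cases h1 : (k : ℕ) ∣ (j : ℕ)
    · -- birth: j = k·n
      obtain ⟨n, hn⟩ := h1
      have hn0 : n ≠ 0 := by intro h; rw [h, mul_zero] at hn; omega
      have hnpos : (0 : ℝ) < n := by exact_mod_cast Nat.pos_of_ne_zero hn0
      have hdiv : (j : ℕ) / (k : ℕ) = n := by rw [hn]; exact Nat.mul_div_cancel_left n hk
      rw [if_pos ⟨n, hn⟩, if_pos ⟨n, hn⟩, hdiv]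
      have hsq : Real.sqrt ((j : ℕ) : ℝ) = Real.sqrt (k : ℕ) * Real.sqrt n := by
        rw [hn, Nat.cast_mul, Real.sqrt_mul hk0.le]
      rw [hsq, show (Λ n : ℝ) / ((n : ℕ) : ℝ) * (Real.sqrt (k : ℕ) * Real.sqrt n) =
        Real.sqrt (k : ℕ) * (Λ n * (Real.sqrt n / n)) by ring, Real.sqrt_div_self']
      ring
    · by_cases h2 : (j : ℕ) ∣ (k : ℕ)
      · -- death: k = j·n
        obtain ⟨n, hn⟩ := h2
        have hn0 : n ≠ 0 := by intro h; rw [h, mul_zero] at hn; omega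
        have hnpos : (0 : ℝ) < n := by exact_mod_cast Nat.pos_of_ne_zero hn0
        have hdiv : (k : ℕ) / (j : ℕ) = n := by rw [hn]; exact Nat.mul_div_cancel_left n hj
        rw [if_neg h1, if_pos ⟨n, hn⟩, if_neg h1, if_pos ⟨n, hn⟩, hdiv]
        have hsq : Real.sqrt ((k : ℕ) : ℝ) = Real.sqrt (j : ℕ) * Real.sqrt n := by
          rw [hn, Nat.cast_mul, Real.sqrt_mul hj0.le]
        rw [hsq]
        have hsn : Real.sqrt n ≠ 0 := (Real.sqrt_pos.2 hnpos).ne'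
        field_simp
      · rw [if_neg h1, if_neg h2, if_neg h1, if_neg h2, mul_zero, zero_mul]

/-- `Δ = diag(√k)` is invertible. -/
theorem isUnit_diagonal_sqrt (M : ℕ) : IsUnit (diagonal (fun k : St M => Real.sqrt (k : ℕ))) := by
  rw [isUnit_iff_isUnit_det, det_diagonal, isUnit_iff_ne_zero]
  refine Finset.prod_ne_zero_iff.2 fun k _ => ?_
  have hk : (0 : ℝ) < (k : ℕ) := by exact_mod_cast (Finset.mem_Icc.1 k.2).1
  exact (Real.sqrt_pos.2 hk).ne'

/-- **The diagonal of the two semigroups coincide**: for every real `t` and state `k`,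
`(e^{tN_M})_{kk} = (e^{t(L·walkGen M + diag R)})_{kk}` — in particular the return probability of the
`R`-tilted walk from `1` is the `(1,1)` entry of `e^{tN_M}` (PIVOT-LAW 13.10 (v)). -/
theorem exp_smul_couplingMatrix_apply_self {M : ℕ} (hM : 2 ≤ M) (t : ℝ) (k : St M) :
    (exp (t • couplingMatrix M)) k k =
      (exp (t • (Real.log M • walkGen M +
          diagonal (fun k : St M => Real.log M * ∑ j : St M, walkRate (Real.log M) k j)))) k k := by
  set Δ : Matrix (St M) (St M) ℝ := diagonal (fun k : St M => Real.sqrt (k : ℕ)) with hΔ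
  set A : Matrix (St M) (St M) ℝ := Real.log M • walkGen M +
      diagonal (fun k : St M => Real.log M * ∑ j : St M, walkRate (Real.log M) k j) with hA
  have hU : IsUnit Δ := isUnit_diagonal_sqrt M
  have hdet : IsUnit Δ.det := (isUnit_iff_isUnit_det Δ).1 hU
  have hconj : Δ * couplingMatrix M = A * Δ := diagonal_sqrt_mul_couplingMatrix hM
  -- N = Δ⁻¹ A Δ, hence tN = Δ⁻¹ (tA) Δ and e^{tN} = Δ⁻¹ e^{tA} Δ
  have hN' : t • couplingMatrix M = Δ⁻¹ * (t • A) * Δ := by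
    have h1 : couplingMatrix M = Δ⁻¹ * (A * Δ) := by
      rw [← hconj, ← Matrix.mul_assoc, nonsing_inv_mul _ hdet, Matrix.one_mul]
    rw [h1, Matrix.mul_assoc, Matrix.smul_mul, Matrix.mul_smul]
  have hexp : exp (t • couplingMatrix M) = Δ⁻¹ * exp (t • A) * Δ := by
    rw [hN', Matrix.exp_conj' _ _ hU]
  -- diagonal entries of Δ⁻¹ X Δ equal those of X: compare Δ·(Δ⁻¹XΔ) = X·Δ at (k,k)
  have hY : Δ * exp (t • couplingMatrix M) = exp (t • A) * Δ := by
    rw [hexp, ← Matrix.mul_assoc, ← Matrix.mul_assoc, mul_nonsing_inv _ hdet, Matrix.one_mul]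
  have hkk := congrFun (congrFun hY k) k
  rw [hΔ, diagonal_mul, mul_diagonal] at hkk
  have hsk : Real.sqrt ((k : ℕ) : ℝ) ≠ 0 := by
    have hk : (0 : ℝ) < (k : ℕ) := by exact_mod_cast (Finset.mem_Icc.1 k.2).1
    exact (Real.sqrt_pos.2 hk).ne'
  have := mul_comm (Real.sqrt ((k : ℕ) : ℝ)) ((exp (t • couplingMatrix M)) k k)
  rw [this] at hkk
  exact mul_right_cancel₀ hsk hkk

/-! ### The Feynman–Kac sandwich between `e^{tN_M}` and the pure walk -/

/-- `L·walkGen M` is a Metzler matrix. -/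
theorem log_smul_walkGen_offdiag_nonneg (M : ℕ) :
    ∀ i j : St M, i ≠ j → 0 ≤ (Real.log M • walkGen M) i j := fun i j hij => by
  rw [Matrix.smul_apply, smul_eq_mul]
  exact mul_nonneg (Real.log_natCast_nonneg M) (walkGen_offdiag_nonneg M i j hij)

/-- **Upper half of the sandwich**: `(e^{tN_M})_{kk} ≤ e^{(log M + 6)t}·(e^{(t·log M)·walkGen M})_{kk}` for
`t ≥ 0`, `M ≥ 2`. -/
theorem exp_couplingMatrix_apply_self_le {M : ℕ} (hM : 2 ≤ M) {t : ℝ} (ht : 0 ≤ t) (k : St M) :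
    (exp (t • couplingMatrix M)) k k ≤
      Real.exp ((Real.log M + 6) * t) * (exp ((t * Real.log M) • walkGen M)) k k := by
  rw [exp_smul_couplingMatrix_apply_self hM t k]
  have h := exp_smul_add_diagonal_apply_le (log_smul_walkGen_offdiag_nonneg M)
    (d := fun k : St M => Real.log M * ∑ j : St M, walkRate (Real.log M) k j)
    (fun i => walkTotalRate_le hM i) ht k k
  rwa [smul_smul] at h

/-- **Lower half of the sandwich**: `e^{(log M − 6)t}·(e^{(t·log M)·walkGen M})_{kk} ≤ (e^{tN_M})_{kk}` for
`t ≥ 0`, `M ≥ 2`. -/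
theorem exp_couplingMatrix_apply_self_ge {M : ℕ} (hM : 2 ≤ M) {t : ℝ} (ht : 0 ≤ t) (k : St M) :
    Real.exp ((Real.log M - 6) * t) * (exp ((t * Real.log M) • walkGen M)) k k ≤
      (exp (t • couplingMatrix M)) k k := by
  rw [exp_smul_couplingMatrix_apply_self hM t k]
  have h := exp_smul_add_diagonal_apply_ge (log_smul_walkGen_offdiag_nonneg M)
    (d := fun k : St M => Real.log M * ∑ j : St M, walkRate (Real.log M) k j)
    (fun i => le_walkTotalRate hM i) ht k k
  rwa [smul_smul] at h

end Summit.RiemannHypothesis.RiemannHypothesis.Theorems.IntegerScrew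

end
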